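import Literature.MathematicalPhysics.QuantumLattice.PairStructureFactorWindowTightness
import Literature.MathematicalPhysics.QuantumLattice.GroundStateSourceWindowBracket
import Literature.MathematicalPhysics.QuantumLattice.SourcedGroundStatePairLROFloor
import HarnessLib

/-!
# Ground-state VECTORS of the pair-sourced `t–t'` torus at field `h`: Griffiths' bracket in the thermodynamic
# limit, and the FLOOR `(∂⁻E(h)/2)²` on their torus pair long-range order

Topic `Literature/MathematicalPhysics/QuantumLattice` (namespace = path; family `hubbard`). The TORUS twin of
`SourcedGroundStatePairLROFloor.lean` (hubbard-cq-p5/transplant-1 (F): every translation-invariant INFINITE-volume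
ground state `ω` of `Ψ_h`, `h > 0`, has box pair LRO `≥ (∂⁻E(h)/2)²`), written for the Koma–Tasaki dictionary of
the Hubbard cuprate cell (`hubbard-cq`, seat p4): here the objects are unit ground-state VECTORS `ψ_L` of the sourced
tori `A_L(t',U,μ,h) = dWaveSourceTorusTT' L t' U μ h` and the torus pair-LRO functional
`s_L(ψ) = torusDiagonal dWaveFormFactor L ψ = L⁻⁴ Re⟨ψ, Δ_d†Δ_d ψ⟩` (hubbard-cq-p6). Inputs: the model-free
vector Griffiths bracket (`GroundStateSourceWindowBracket.lean`, hubbard-cq-obsth-3), the thermodynamic limit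
`E_L(h)/L² → E(h) = dWaveSourceEnergyDensityTT' t' U μ h` (hubbard-cq-obsth-2) and the one-sided derivatives of
the concave `E` (hubbard-cq-p5). Everything is PROVED; no definition, no named fact, zero compute.

* §1 (finite `L`, model-free) `norm_expect_sq_le_re_expect_conjTranspose_mul_self`: `‖⟨ψ,Aψ⟩‖² ≤ Re⟨ψ,A†Aψ⟩`
  for a unit vector; `sq_re_expect_pairField_div_le_torusDiagonal`: `(Re⟨ψ,Δ_gψ⟩/L²)² ≤ s_L(ψ)`.
* §2 (finite `L`) the Griffiths bracket for ground-state VECTORS of `A_L(h)`: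
  `(E_L(h−δ) − E_L(h))/δ ≤ 2Re⟨ψ,Δ_dψ⟩ ≤ (E_L(h) − E_L(h+δ))/δ` (`δ > 0`; `E_L = E₀(A_L(·))`).
* §3 (thermodynamic limit, any real `h`, sides `L_j → ∞`): `tendsto_groundEnergy_dWaveSourceTorusTT'_div_sq_comp`
  (`E_{L_j}(h)/L_j² → E(h)`), and for unit ground-state vectors `ψ_{L_j}`:
  `∀ η > 0`, eventually `−∂⁻E(h) − η ≤ 2Re⟨ψ,Δ_dψ⟩/L² ≤ −∂⁺E(h) + η`
  (`eventually_le_two_mul_re_expect_pairField_div`, `eventually_two_mul_re_expect_pairField_div_le`) — Griffiths'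
  theorem for VECTOR states; at a differentiability point `2Re⟨ψ,Δ_dψ⟩/L² → −E'(h)`
  (`tendsto_two_mul_re_expect_pairField_div_of_hasDerivAt`).
* §4 **THE TORUS FLOOR at `h > 0`**: `∀ ε > 0`, eventually `(∂⁻E(h)/2)² − ε ≤ s_{L_j}(ψ_{L_j})`
  (`eventually_sq_half_leftDeriv_sub_le_torusDiagonal`) — explicit symmetry breaking floors the torus pair LRO
  of every ground-state sequence by the square of the smaller Griffiths amplitude. Together with the venture-side
  ceiling `(∂⁺E(h)/2)² + ε` (`Observables/TorusPairLROCeilingTTPrime.lean`) this is the finite-`h` band on the torus;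
  off the kinks of `E` the torus pair LRO of sourced ground states converges to the response squared.

HONEST SCOPE: statements at `h > 0` (explicit symmetry breaking) or brackets by one-sided derivatives; at `h = 0`
the floor is `(∂⁻E(0)/2)² = (m⋆)²` only formally — §4 requires `h > 0` (for `h = 0` ground states the amplitude
`Re⟨ψ,Δψ⟩` vanishes in every fixed-`N` sector and no floor follows; that is the torus half [U] ∧ [BN7] of the
dictionary). Nothing here bears on `d`-wave order at zero field.

## References
* R. B. Griffiths, Phys. Rev. 152 (1966) 240, §II (one-sided derivatives of a concave ground energy bound the
  conjugate expectation in every ground state). [cite: Griffiths1966, §II]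
* T. Koma, H. Tasaki, J. Stat. Phys. 76 (1994) 745, §1 (sourced ground states on periodic boxes, volume limit
  first). [cite: KomaTasaki1994, §1]
* H. Tasaki, *Physics and Mathematics of Quantum Many-Body Systems* (2020), §2.1 (variational principle).
  [cite: Tasaki2020, §2.1]
-/

noncomputable section

namespace Literature.MathematicalPhysics.QuantumLattice

open Matrix Finset _root_.Filter Literature.Probability.LatticeModels HubbardWave0 Set
open scoped _root_.Topology ComplexOrder

/-! ### §1 Cauchy–Schwarz for vector states; the torus diagonal dominates the squared amplitude -/

section Vector

/-- **`‖⟨ψ, Aψ⟩‖² ≤ Re⟨ψ, A†A ψ⟩` for a unit vector** (`⟨ψ,A†Aψ⟩ = ‖Aψ‖²` and Cauchy–Schwarz).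
[cite: Tasaki2020, §2.1] -/
theorem norm_expect_sq_le_re_expect_conjTranspose_mul_self {ι : Type*} [LinearOrder ι] [Fintype ι]
    (A : Matrix (Finset ι) (Finset ι) ℂ) {ψ : Fock ι} (hψ : star ψ ⬝ᵥ ψ = 1) :
    ‖expect A ψ‖ ^ 2 ≤ (expect (Aᴴ * A) ψ).re := by
  have h1 := norm_star_dotProduct_le_eucNorm hψ (A *ᵥ ψ)
  have h2 : eucNorm (A *ᵥ ψ) ^ 2 = (expect (Aᴴ * A) ψ).re := by
    rw [eucNorm_sq, expect, ← mulVec_mulVec, star_mulVec]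
    simp only [dotProduct_mulVec, vecMul_vecMul]
  rw [← h2]
  exact pow_le_pow_left₀ (norm_nonneg _) h1 2

/-- `(Re⟨ψ, Aψ⟩)² ≤ Re⟨ψ, A†A ψ⟩` for a unit vector. [cite: Tasaki2020, §2.1] -/
theorem sq_re_expect_le_re_expect_conjTranspose_mul_self {ι : Type*} [LinearOrder ι] [Fintype ι]
    (A : Matrix (Finset ι) (Finset ι) ℂ) {ψ : Fock ι} (hψ : star ψ ⬝ᵥ ψ = 1) :
    (expect A ψ).re ^ 2 ≤ (expect (Aᴴ * A) ψ).re := by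
  refine le_trans ?_ (norm_expect_sq_le_re_expect_conjTranspose_mul_self A hψ)
  rw [sq_le_sq, abs_norm]
  exact Complex.abs_re_le_norm _

/-- `⟨ψ, (A + A†)ψ⟩` is real with real part `2 Re⟨ψ, Aψ⟩`. [folklore] -/
private theorem re_star_dotProduct_add_conjTranspose_mulVec {ι : Type*} [Fintype ι]
    (A : Matrix (Finset ι) (Finset ι) ℂ) (ψ : Fock ι) :
    (star ψ ⬝ᵥ (A + Aᴴ) *ᵥ ψ).re = 2 * (star ψ ⬝ᵥ A *ᵥ ψ).re := by
  have hconj : star ψ ⬝ᵥ Aᴴ *ᵥ ψ = star (star ψ ⬝ᵥ A *ᵥ ψ) := by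
    rw [star_dotProduct ψ (Aᴴ *ᵥ ψ), star_mulVec, conjTranspose_conjTranspose, ← dotProduct_mulVec]
  rw [add_mulVec, dotProduct_add, Complex.add_re, hconj, Complex.star_def, Complex.conj_re]
  ring

variable (g : Site 2 → ℝ) (L : ℕ) [NeZero L]

/-- **The torus diagonal dominates the squared pair amplitude**: for a unit torus vector,
`(Re⟨ψ, Δ_gψ⟩/L²)² ≤ s_L(ψ) = L⁻⁴ Re⟨ψ, Δ_g†Δ_g ψ⟩`. [cite: KomaTasaki1994, §1] -/
theorem sq_re_expect_pairField_div_le_torusDiagonal {ψ : Fock (Orb (FermionTorus 2 L))}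
    (hψ : star ψ ⬝ᵥ ψ = 1) :
    ((expect (pairField g L) ψ).re / (L : ℝ) ^ 2) ^ 2 ≤ torusDiagonal g L ψ := by
  have hL : (0 : ℝ) < (L : ℝ) ^ 2 := by
    have : (0 : ℝ) < L := by exact_mod_cast Nat.pos_of_ne_zero (NeZero.ne L)
    positivity
  have hcs := sq_re_expect_le_re_expect_conjTranspose_mul_self (pairField g L) hψ
  rw [torusDiagonal, pairStructureFactor_zero, div_div, div_pow, ← pow_mul]
  rw [show (L : ℝ) ^ 2 * (L : ℝ) ^ 2 = (L : ℝ) ^ (2 * 2) by ring]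
  exact div_le_div_of_nonneg_right hcs (by positivity)

end Vector

/-! ### §2 The Griffiths bracket for ground-state vectors of the sourced torus -/

section Bracket

variable (L : ℕ) [NeZero L] (t' U μ : ℝ)

/-- The sourced torus as `K − h•O` with `K = hubbardTorusTT' − μN`, `O = Δ_d + Δ_d†`. [cite: KomaTasaki1994, §1] -/
theorem dWaveSourceTorusTT'_eq_sub_smul (h : ℝ) :
    dWaveSourceTorusTT' L t' U μ h =
      (hubbardTorusTT' L 1 t' U - (μ : ℂ) • totalNumber) -
        (h : ℂ) • (pairField dWaveFormFactor L + (pairField dWaveFormFactor L)ᴴ) := rfl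

variable {L t' U μ}

/-- **Griffiths' lower bracket for a ground-state VECTOR** of `A_L(h)`: for `δ > 0`,
`(E_L(h−δ) − E_L(h))/δ ≤ 2 Re⟨ψ, Δ_dψ⟩` (variational principle at `h − δ` with trial state `ψ`).
[cite: Griffiths1966, §II] -/
theorem sub_groundEnergy_div_le_two_mul_re_expect_pairField {h : ℝ} {ψ : Fock (Orb (FermionTorus 2 L))}
    (hψ : star ψ ⬝ᵥ ψ = 1)
    (hgs : dWaveSourceTorusTT' L t' U μ h *ᵥ ψ = (((dWaveSourceTorusTT' L t' U μ h).groundEnergy : ℝ) : ℂ) • ψ)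
    {δ : ℝ} (hδ : 0 < δ) :
    ((dWaveSourceTorusTT' L t' U μ (h - δ)).groundEnergy - (dWaveSourceTorusTT' L t' U μ h).groundEnergy) / δ ≤
      2 * (expect (pairField dWaveFormFactor L) ψ).re := by
  have hK := (hubbardTorusTT'_isHermitian L 1 t' U).sub (isHermitian_real_smul totalNumber_isHermitian μ)
  have hO := isHermitian_pairField_add_conjTranspose L
  have key := groundEnergy_source_le_re_rayleigh_sub hK hO hψ h (h - δ)
  rw [← dWaveSourceTorusTT'_eq_sub_smul, ← dWaveSourceTorusTT'_eq_sub_smul, re_rayleigh_of_eigenvector hψ hgs,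
    re_star_dotProduct_add_conjTranspose_mulVec] at key
  rw [div_le_iff₀ hδ]
  have : (h - δ - h) = -δ := by ring
  rw [this] at key
  unfold expect
  linarith

/-- **Griffiths' upper bracket for a ground-state VECTOR** of `A_L(h)`: for `δ > 0`,
`2 Re⟨ψ, Δ_dψ⟩ ≤ (E_L(h) − E_L(h+δ))/δ`. [cite: Griffiths1966, §II] -/
theorem two_mul_re_expect_pairField_le_sub_groundEnergy_div {h : ℝ} {ψ : Fock (Orb (FermionTorus 2 L))}
    (hψ : star ψ ⬝ᵥ ψ = 1)
    (hgs : dWaveSourceTorusTT' L t' U μ h *ᵥ ψ = (((dWaveSourceTorusTT' L t' U μ h).groundEnergy : ℝ) : ℂ) • ψ)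
    {δ : ℝ} (hδ : 0 < δ) :
    2 * (expect (pairField dWaveFormFactor L) ψ).re ≤
      ((dWaveSourceTorusTT' L t' U μ h).groundEnergy - (dWaveSourceTorusTT' L t' U μ (h + δ)).groundEnergy) / δ := by
  have hK := (hubbardTorusTT'_isHermitian L 1 t' U).sub (isHermitian_real_smul totalNumber_isHermitian μ)
  have hO := isHermitian_pairField_add_conjTranspose L
  have key := groundEnergy_source_le_re_rayleigh_sub hK hO hψ h (h + δ)
  rw [← dWaveSourceTorusTT'_eq_sub_smul, ← dWaveSourceTorusTT'_eq_sub_smul, re_rayleigh_of_eigenvector hψ hgs,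
    re_star_dotProduct_add_conjTranspose_mulVec] at key
  rw [le_div_iff₀ hδ]
  have : (h + δ - h) = δ := by ring
  rw [this] at key
  unfold expect
  linarith

end Bracket

/-! ### §3 The thermodynamic limit of the bracket: Griffiths' theorem for vector states -/

section Limit

variable {ψ : ∀ L, Fock (Orb (FermionTorus 2 L))} {Ls : ℕ → ℕ}

/-- **`E_{L_j}(h)/L_j² → E(h)` along any divergent sequence of sides.** [cite: KomaTasaki1994, §1] -/
theorem tendsto_groundEnergy_dWaveSourceTorusTT'_div_sq_comp [∀ j, NeZero (Ls j)] (hLs : Tendsto Ls atTop atTop)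
    (t' U μ h : ℝ) :
    Tendsto (fun j => (dWaveSourceTorusTT' (Ls j) t' U μ h).groundEnergy / ((Ls j : ℝ)) ^ 2) atTop
      (𝓝 (dWaveSourceEnergyDensityTT' t' U μ h)) := by
  set G : ℕ → ℝ := fun K =>
    (dWaveSourceTorusTT' (K + 1) t' U μ h).groundEnergy / (((K + 1 : ℕ) : ℝ)) ^ 2 with hG
  have key : ∀ (n : ℕ) [NeZero n], G (n - 1) = (dWaveSourceTorusTT' n t' U μ h).groundEnergy / ((n : ℝ)) ^ 2 := by
    intro n hn
    obtain ⟨K, rfl⟩ := Nat.exists_eq_succ_of_ne_zero hn.out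
    simp only [hG, Nat.succ_sub_one]
  have h1 := (tendsto_dWaveSourceEnergyDensityTT' t' U μ h).comp ((tendsto_sub_atTop_nat 1).comp hLs)
  refine h1.congr fun j => ?_
  simp only [Function.comp_def]
  exact key (Ls j)

variable [∀ j, NeZero (Ls j)] {t' U μ h : ℝ}

/-- **Griffiths' theorem for ground-state VECTORS, lower half** (any real `h`): along unit ground-state vectors
`ψ_{L_j}` of `A_{L_j}(h)`, `∀ η > 0`, eventually `−∂⁻E(h) − η ≤ 2 Re⟨ψ, Δ_dψ⟩/L²`. [cite: Griffiths1966, §II] -/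
theorem eventually_le_two_mul_re_expect_pairField_div (hLs : Tendsto Ls atTop atTop)
    (hunit : ∀ j, star (ψ (Ls j)) ⬝ᵥ ψ (Ls j) = 1)
    (hgs : ∀ j, dWaveSourceTorusTT' (Ls j) t' U μ h *ᵥ ψ (Ls j) =
      (((dWaveSourceTorusTT' (Ls j) t' U μ h).groundEnergy : ℝ) : ℂ) • ψ (Ls j))
    {η : ℝ} (hη : 0 < η) :
    ∀ᶠ j in atTop, -derivWithin (dWaveSourceEnergyDensityTT' t' U μ) (Iio h) h - η ≤
      2 * (expect (pairField dWaveFormFactor (Ls j)) (ψ (Ls j))).re / ((Ls j : ℝ)) ^ 2 := by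
  set E := dWaveSourceEnergyDensityTT' t' U μ with hE
  set D := derivWithin E (Iio h) h with hD
  -- a left secant slope within `η/2` of the left derivative
  have hd := (hasDerivWithinAt_Ioi_Iio_dWaveSourceEnergyDensityTT' t' U μ h).2
  have ht : Tendsto (slope E h) (𝓝[<] h) (𝓝 D) := by
    have := hasDerivWithinAt_iff_tendsto_slope.1 hd
    rwa [show Iio h \ {h} = Iio h from by simp] at this
  have hev : ∀ᶠ s in 𝓝[<] h, dist (slope E h s) D < η / 2 := Metric.tendsto_nhds.1 ht (η / 2) (by linarith)
  obtain ⟨s, hs, hslt⟩ := (hev.and self_mem_nhdsWithin).exists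
  replace hslt : s < h := hslt
  set δ := h - s with hδ
  have hδpos : 0 < δ := by rw [hδ]; linarith
  have hslope : slope E h s = -((E (h - δ) - E h) / δ) := by
    rw [slope_def_field, show s = h - δ by rw [hδ]; ring]
    have : h - δ - h = -δ := by ring
    rw [this, div_neg]
  have hsec : -D - η / 2 ≤ (E (h - δ) - E h) / δ := by
    rw [Real.dist_eq, hslope] at hs
    have := (abs_lt.1 hs).2
    linarith
  -- the finite-volume secants converge
  have hconv : Tendsto (fun j => ((dWaveSourceTorusTT' (Ls j) t' U μ (h - δ)).groundEnergy / ((Ls j : ℝ)) ^ 2 -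
      (dWaveSourceTorusTT' (Ls j) t' U μ h).groundEnergy / ((Ls j : ℝ)) ^ 2) / δ) atTop
      (𝓝 ((E (h - δ) - E h) / δ)) :=
    ((tendsto_groundEnergy_dWaveSourceTorusTT'_div_sq_comp hLs t' U μ (h - δ)).sub
      (tendsto_groundEnergy_dWaveSourceTorusTT'_div_sq_comp hLs t' U μ h)).div_const δ
  have hev2 := hconv.eventually (Ici_mem_nhds (show (E (h - δ) - E h) / δ - η / 2 < (E (h - δ) - E h) / δ by
    linarith))
  filter_upwards [hev2] with j hj
  have hL : (0 : ℝ) < ((Ls j : ℝ)) ^ 2 := by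
    have : (0 : ℝ) < (Ls j : ℝ) := by exact_mod_cast Nat.pos_of_ne_zero (NeZero.ne (Ls j))
    positivity
  have hbr := sub_groundEnergy_div_le_two_mul_re_expect_pairField (hunit j) (hgs j) hδpos
  -- divide the finite-volume bracket by `L²`
  have hbr' : ((dWaveSourceTorusTT' (Ls j) t' U μ (h - δ)).groundEnergy / ((Ls j : ℝ)) ^ 2 -
      (dWaveSourceTorusTT' (Ls j) t' U μ h).groundEnergy / ((Ls j : ℝ)) ^ 2) / δ ≤
      2 * (expect (pairField dWaveFormFactor (Ls j)) (ψ (Ls j))).re / ((Ls j : ℝ)) ^ 2 := by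
    rw [← sub_div, div_div, mul_comm (((Ls j : ℝ)) ^ 2) δ, ← div_div]
    exact div_le_div_of_nonneg_right hbr hL.le
  linarith

/-- **Griffiths' theorem for ground-state VECTORS, upper half** (any real `h`): `∀ η > 0`, eventually
`2 Re⟨ψ, Δ_dψ⟩/L² ≤ −∂⁺E(h) + η`. [cite: Griffiths1966, §II] -/
theorem eventually_two_mul_re_expect_pairField_div_le (hLs : Tendsto Ls atTop atTop)
    (hunit : ∀ j, star (ψ (Ls j)) ⬝ᵥ ψ (Ls j) = 1)
    (hgs : ∀ j, dWaveSourceTorusTT' (Ls j) t' U μ h *ᵥ ψ (Ls j) =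
      (((dWaveSourceTorusTT' (Ls j) t' U μ h).groundEnergy : ℝ) : ℂ) • ψ (Ls j))
    {η : ℝ} (hη : 0 < η) :
    ∀ᶠ j in atTop, 2 * (expect (pairField dWaveFormFactor (Ls j)) (ψ (Ls j))).re / ((Ls j : ℝ)) ^ 2 ≤
      -derivWithin (dWaveSourceEnergyDensityTT' t' U μ) (Ioi h) h + η := by
  set E := dWaveSourceEnergyDensityTT' t' U μ with hE
  set D := derivWithin E (Ioi h) h with hD
  have hd := (hasDerivWithinAt_Ioi_Iio_dWaveSourceEnergyDensityTT' t' U μ h).1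
  have ht : Tendsto (slope E h) (𝓝[>] h) (𝓝 D) := by
    have := hasDerivWithinAt_iff_tendsto_slope.1 hd
    rwa [show Ioi h \ {h} = Ioi h from by simp] at this
  have hev : ∀ᶠ s in 𝓝[>] h, dist (slope E h s) D < η / 2 := Metric.tendsto_nhds.1 ht (η / 2) (by linarith)
  obtain ⟨s, hs, hslt⟩ := (hev.and self_mem_nhdsWithin).exists
  replace hslt : h < s := hslt
  set δ := s - h with hδ
  have hδpos : 0 < δ := by rw [hδ]; linarith
  have hslope : slope E h s = -((E h - E (h + δ)) / δ) := by
    rw [slope_def_field, show s = h + δ by rw [hδ]; ring]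
    have : h + δ - h = δ := by ring
    rw [this, ← neg_div, neg_sub]
  have hsec : (E h - E (h + δ)) / δ ≤ -D + η / 2 := by
    rw [Real.dist_eq, hslope] at hs
    have := (abs_lt.1 hs).1
    linarith
  have hconv : Tendsto (fun j => ((dWaveSourceTorusTT' (Ls j) t' U μ h).groundEnergy / ((Ls j : ℝ)) ^ 2 -
      (dWaveSourceTorusTT' (Ls j) t' U μ (h + δ)).groundEnergy / ((Ls j : ℝ)) ^ 2) / δ) atTop
      (𝓝 ((E h - E (h + δ)) / δ)) :=
    ((tendsto_groundEnergy_dWaveSourceTorusTT'_div_sq_comp hLs t' U μ h).sub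
      (tendsto_groundEnergy_dWaveSourceTorusTT'_div_sq_comp hLs t' U μ (h + δ))).div_const δ
  have hev2 := hconv.eventually (Iic_mem_nhds (show (E h - E (h + δ)) / δ < (E h - E (h + δ)) / δ + η / 2 by
    linarith))
  filter_upwards [hev2] with j hj
  have hL : (0 : ℝ) < ((Ls j : ℝ)) ^ 2 := by
    have : (0 : ℝ) < (Ls j : ℝ) := by exact_mod_cast Nat.pos_of_ne_zero (NeZero.ne (Ls j))
    positivity
  have hbr := two_mul_re_expect_pairField_le_sub_groundEnergy_div (hunit j) (hgs j) hδpos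
  have hbr' : 2 * (expect (pairField dWaveFormFactor (Ls j)) (ψ (Ls j))).re / ((Ls j : ℝ)) ^ 2 ≤
      ((dWaveSourceTorusTT' (Ls j) t' U μ h).groundEnergy / ((Ls j : ℝ)) ^ 2 -
        (dWaveSourceTorusTT' (Ls j) t' U μ (h + δ)).groundEnergy / ((Ls j : ℝ)) ^ 2) / δ := by
    rw [← sub_div, div_div, mul_comm (((Ls j : ℝ)) ^ 2) δ, ← div_div]
    exact div_le_div_of_nonneg_right hbr hL.le
  linarith

/-- **At a differentiability point of `E` the pair amplitudes of ALL ground-state vectors converge to the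
response**: `2 Re⟨ψ_{L_j}, Δ_dψ_{L_j}⟩/L_j² → −E'(h)`. [cite: Griffiths1966, §II] -/
theorem tendsto_two_mul_re_expect_pairField_div_of_hasDerivAt (hLs : Tendsto Ls atTop atTop)
    (hunit : ∀ j, star (ψ (Ls j)) ⬝ᵥ ψ (Ls j) = 1)
    (hgs : ∀ j, dWaveSourceTorusTT' (Ls j) t' U μ h *ᵥ ψ (Ls j) =
      (((dWaveSourceTorusTT' (Ls j) t' U μ h).groundEnergy : ℝ) : ℂ) • ψ (Ls j))
    {e' : ℝ} (hd : HasDerivAt (dWaveSourceEnergyDensityTT' t' U μ) e' h) :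
    Tendsto (fun j => 2 * (expect (pairField dWaveFormFactor (Ls j)) (ψ (Ls j))).re / ((Ls j : ℝ)) ^ 2) atTop
      (𝓝 (-e')) := by
  have hR : derivWithin (dWaveSourceEnergyDensityTT' t' U μ) (Ioi h) h = e' :=
    hd.hasDerivWithinAt.derivWithin (uniqueDiffWithinAt_Ioi h)
  have hL' : derivWithin (dWaveSourceEnergyDensityTT' t' U μ) (Iio h) h = e' :=
    hd.hasDerivWithinAt.derivWithin (uniqueDiffWithinAt_Iio h)
  rw [Metric.tendsto_atTop]
  intro η hη
  have h1 := eventually_le_two_mul_re_expect_pairField_div hLs hunit hgs (half_pos hη)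
  have h2 := eventually_two_mul_re_expect_pairField_div_le hLs hunit hgs (half_pos hη)
  rw [hL'] at h1
  rw [hR] at h2
  obtain ⟨J, hJ⟩ := eventually_atTop.1 (h1.and h2)
  refine ⟨J, fun j hj => ?_⟩
  obtain ⟨hlo, hhi⟩ := hJ j hj
  rw [Real.dist_eq, abs_lt]
  constructor <;> linarith

/-! ### §4 The torus FLOOR at `h > 0` -/

/-- **THE TORUS FLOOR `(∂⁻E(h)/2)²` AT A POSITIVE FIELD**: along unit ground-state vectors `ψ_{L_j}` of the
pair-sourced tori `A_{L_j}(t',U,μ,h)`, `h > 0`, for every `ε > 0` eventually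
`(∂⁻E(h)/2)² − ε ≤ s_{L_j}(ψ_{L_j}) = L⁻⁴ Re⟨ψ, Δ_d†Δ_d ψ⟩` (Griffiths' lower bracket, `∂⁻E(h) ≤ 0` at `h > 0`,
and `s_L ≥ (Re⟨ψ,Δ_dψ⟩/L²)²`). [cite: Griffiths1966, §II] -/
theorem eventually_sq_half_leftDeriv_sub_le_torusDiagonal (hLs : Tendsto Ls atTop atTop) (hh : 0 < h)
    (hunit : ∀ j, star (ψ (Ls j)) ⬝ᵥ ψ (Ls j) = 1)
    (hgs : ∀ j, dWaveSourceTorusTT' (Ls j) t' U μ h *ᵥ ψ (Ls j) =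
      (((dWaveSourceTorusTT' (Ls j) t' U μ h).groundEnergy : ℝ) : ℂ) • ψ (Ls j))
    {ε : ℝ} (hε : 0 < ε) :
    ∀ᶠ j in atTop, (derivWithin (dWaveSourceEnergyDensityTT' t' U μ) (Iio h) h / 2) ^ 2 - ε ≤
      torusDiagonal dWaveFormFactor (Ls j) (ψ (Ls j)) := by
  set D := -derivWithin (dWaveSourceEnergyDensityTT' t' U μ) (Iio h) h with hD
  have hD0 : 0 ≤ D := by
    have := leftDeriv_dWaveSourceEnergyDensityTT'_nonpos t' U μ hh
    rw [hD]; linarith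
  have hsq : (derivWithin (dWaveSourceEnergyDensityTT' t' U μ) (Iio h) h / 2) ^ 2 = (D / 2) ^ 2 := by
    rw [hD]; ring
  rw [hsq]
  rcases hD0.eq_or_lt with hzero | hpos
  · -- `D = 0`: the floor is `−ε ≤ s`, true since `s ≥ 0`
    refine Eventually.of_forall fun j => ?_
    have := torusDiagonal_nonneg dWaveFormFactor (Ls j) (ψ (Ls j))
    rw [← hzero]
    linarith
  · -- `D > 0`: take `η = min (D/2) (ε/D)`
    set η := min (D / 2) (ε / D) with hη
    have hηpos : 0 < η := lt_min (by linarith) (div_pos hε hpos)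
    have hη1 : η ≤ D / 2 := min_le_left _ _
    have hη2 : η * D ≤ ε := by
      have := min_le_right (D / 2) (ε / D)
      rw [← hη] at this
      calc η * D ≤ ε / D * D := mul_le_mul_of_nonneg_right this hpos.le
        _ = ε := div_mul_cancel₀ ε hpos.ne'
    have hev := eventually_le_two_mul_re_expect_pairField_div hLs hunit hgs hηpos
    filter_upwards [hev] with j hj
    rw [← hD] at hj
    set x := (expect (pairField dWaveFormFactor (Ls j)) (ψ (Ls j))).re / ((Ls j : ℝ)) ^ 2 with hx
    have hx2 : 2 * (expect (pairField dWaveFormFactor (Ls j)) (ψ (Ls j))).re / ((Ls j : ℝ)) ^ 2 = 2 * x := by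
      rw [hx]; ring
    rw [hx2] at hj
    -- `x ≥ (D − η)/2 ≥ D/4 > 0`
    have hxlo : (D - η) / 2 ≤ x := by linarith
    have hx0 : 0 ≤ (D - η) / 2 := by linarith
    have hs := sq_re_expect_pairField_div_le_torusDiagonal dWaveFormFactor (Ls j) (hunit j)
    rw [← hx] at hs
    have hsq2 : ((D - η) / 2) ^ 2 ≤ x ^ 2 := pow_le_pow_left₀ hx0 hxlo 2
    -- `((D − η)/2)² ≥ (D/2)² − ηD/2 ≥ (D/2)² − ε`
    nlinarith [hsq2, hs, hη2, hηpos.le, sq_nonneg η]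

end Limit

end Literature.MathematicalPhysics.QuantumLattice

end
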